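import Summits.Ventures.GridStability.Models.PolynomialiseRel

/-!
# Recast of `n` machines tied to an infinite bus (multi-machine–infinite-bus; rung G1.a′)

Venture GRIDFUSION, cell `run/shared/lean/pub/gridfusion/`, PARTITION A8 (rung G1.a′ = the
Chiang-2011 three-bus cycle as printed by Josz–Molzahn–Tacchi–Sojoudi, ISGT 2019, arXiv:1811.01372
§II-A: «three synchronous machines connected in a cycle … the third bus sets the reference angle
(θ₃ = 0)», i.e. two machines with ABSOLUTE angles against a bus of fixed angle and frequency
[corpus:paper:arxiv-1811.01372 p0004]); seat gridfusion-model-1.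

Construction: take `RecastData n` (`Polynomialise.lean`) and let node `0` be the INFINITE BUS — its
angle frozen, its speed deviation `0`, no swing equation — while machines `1..n` follow the classical
model `d.toModel` (Anderson–Fouad (2.56) / Sauer–Pai (7.216) with (5.157)). Variables (`3n`): the angle
block of `Polynomialise.lean` (`σ_{i+1} ↦ 2i`, `κ_{i+1} ↦ 2i+1`) and the speeds `ω_{i+1} ↦ 2n + i`
(`= ν_{i+1}` of `PolynomialiseRel.lean`, since `ω_0 ≡ 0`); the embedding is `embedRel`.
Recast: `σ̇_i = (1 − κ_i) ω_i` (`gσ`), `κ̇_i = σ_i ω_i` (`gκ`),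
`ω̇_i = (e_i − P_{e,i}(z))/M_i − (D_i/M_i) ω_i` (`gωInf`, NON-uniform damping allowed).
SMIB (`SMIB.lean`) is the case `n = 1` written out by hand; this file is the general one.

Contents: `gωInf`, `gkInf`, `infField`, `IsInfBusSolutionOn`, `eval_gωInf`, and the exact-embedding
lemma `hasDerivWithinAt_embedInf`. MODELLED as `ClassicalSwing.lean` + the infinite-bus idealisation
(MODEL-VALIDITY row of the instance); nothing here says a grid is stable.
-/

noncomputable section

open Real Finset
open Literature.Computation.Certificates
open Literature.Computation.Certificates.SOS
open Literature.Computation.Certificates.SOS.Poly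

namespace Summit.Ventures.GridStability.Models

namespace RecastData

variable {n : ℕ} (d : RecastData n)

/-- Infinite-bus recast `ω̇_i = (e_i − P_{e,i}(z))/M_i − (D_i/M_i) ω_i`, normalised. -/
def gωInf (i : Fin (n + 1)) : Poly :=
  Poly.norm (add (d.pacc i) (neg (smul (d.D i / d.M i) (pν i))))

/-- Component function of the infinite-bus recast: angle block as `gk`, then `ω̇_{i+1}` at `2n + i`. -/
def gkInf (k : ℕ) : Poly :=
  if h : k < 2 * n then
    (if k % 2 = 0 then gσ (⟨k / 2 + 1, by omega⟩ : Fin (n + 1))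
      else gκ (⟨k / 2 + 1, by omega⟩ : Fin (n + 1)))
  else if h' : k < 3 * n then d.gωInf ⟨k - 2 * n + 1, by omega⟩ else []

/-- The infinite-bus recast field `[g_0, …, g_{3n−1}]` (interface I2 for rung G1.a′). -/
def infField : List Poly := (List.range (3 * n)).map d.gkInf

/-- Component access: `infField[k] = gkInf k` (also beyond the end). -/
theorem infField_getD (k : ℕ) : d.infField.getD k [] = d.gkInf k := by
  unfold infField
  rw [List.getD_eq_getElem?_getD, List.getElem?_map]
  by_cases hk : k < 3 * n
  · simp [List.getElem?_range hk]
  · have h2 : ¬ k < 2 * n := by omega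
    simp [gkInf, hk, h2]

/-- Solutions of the `n`-machine–infinite-bus model on the time set `s`, written on the state space of
`ClassicalSwing (n+1)` with node `0` = the bus: the bus angle is frozen at `δ₀` and its speed
deviation is `0` on `s`, and every machine `i ≠ 0` obeys `dδ_i/dt = ω_i`,
`dω_i/dt = (e_i − P_{e,i}(δ) − D_i ω_i)/M_i` (the `i`-th components of `d.toModel.field`). -/
def IsInfBusSolutionOn (δ₀ : ℝ) (c : ℝ → ClassicalSwing.State (n + 1)) (s : Set ℝ) : Prop :=
  ∀ t ∈ s, (c t).1 0 = δ₀ ∧ (c t).2 0 = 0 ∧ ∀ i : Fin (n + 1), i ≠ 0 →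
    HasDerivWithinAt (fun τ => (c τ).1 i) ((c t).2 i) s t ∧
      HasDerivWithinAt (fun τ => (c τ).2 i) ((d.toModel.field (c t)).2 i) s t

variable {δs : Fin (n + 1) → ℝ} (x : ClassicalSwing.State (n + 1))

/-- Faithful electrical power on the relative embedding, for the model `d.toModel`. -/
theorem eval_pPe_rel_toModel (h : d.EqData δs) (i : Fin (n + 1)) :
    (d.pPe i).eval (embedRel δs x) = d.toModel.Pe x.1 i := by
  rw [d.eval_pPe_rel 0 x h 0 i]; rfl

/-- **Faithful `ω̇` (infinite bus).** With the bus speed deviation `ω_0 = 0`, `gωInf i` evaluates on the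
embedding to the `ω̇_i` of `d.toModel`. -/
theorem eval_gωInf (h : d.EqData δs) (i : Fin (n + 1)) (hM : d.M i ≠ 0) (h0 : x.2 0 = 0) :
    (d.gωInf i).eval (embedRel δs x) = (d.toModel.field x).2 i := by
  have hM' : (d.M i : ℝ) ≠ 0 := by exact_mod_cast hM
  simp only [gωInf, eval_norm, eval_add, eval_neg, eval_smul, pacc, eval_C, d.eval_pPe_rel_toModel x h,
    eval_pν, h0, sub_zero, ClassicalSwing.field, toModel]
  push_cast
  field_simp
  ring

/-- **Exact embedding lemma, infinite-bus form (chain rule).** Along every solution of the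
`n`-machine–infinite-bus model, every recast coordinate `z_k = embedRel δ^s (c τ) k` satisfies
`dz_k/dt = g_k(z)` within `s`, `g = infField`. -/
theorem hasDerivWithinAt_embedInf (h : d.EqData δs) (hM : ∀ i, d.M i ≠ 0) {δ₀ : ℝ}
    {c : ℝ → ClassicalSwing.State (n + 1)} {s : Set ℝ} (hc : d.IsInfBusSolutionOn δ₀ c s)
    {t : ℝ} (ht : t ∈ s) (k : ℕ) :
    HasDerivWithinAt (fun τ => embedRel δs (c τ) k) ((d.infField.getD k []).eval (embedRel δs (c t))) s t := by
  rw [infField_getD]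
  obtain ⟨hδ0, hω0, hsol⟩ := hc t ht
  -- coordinate derivatives: the bus is frozen, the machines follow the model
  have h1 : ∀ j, HasDerivWithinAt (fun τ => (c τ).1 j) ((c t).2 j) s t := by
    intro j
    by_cases hj : j = 0
    · subst hj
      rw [hω0]
      exact (hasDerivWithinAt_const t s δ₀).congr (fun τ hτ => (hc τ hτ).1) hδ0
    · exact ((hsol j hj).1)
  have h2 : ∀ j, j ≠ 0 → HasDerivWithinAt (fun τ => (c τ).2 j) ((d.toModel.field (c t)).2 j) s t :=
    fun j hj => (hsol j hj).2
  have h20 : HasDerivWithinAt (fun τ => (c τ).2 0) 0 s t :=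
    (hasDerivWithinAt_const t s (0 : ℝ)).congr (fun τ hτ => (hc τ hτ).2.1) hω0
  have hu : ∀ j, HasDerivWithinAt (fun τ => u δs (c τ) j) ((c t).2 j - (c t).2 0) s t := fun j => by
    simpa [u] using ((h1 j).sub (h1 0)).sub_const (δs j - δs 0)
  by_cases hk : k < 2 * n
  · by_cases hpar : k % 2 = 0
    · have e1 : ∀ y : ClassicalSwing.State (n + 1), embedRel δs y k = sin (u δs y ⟨k / 2 + 1, by omega⟩) :=
        fun y => by rw [embedRel_of_lt δs y hk, embed_even δs y hk hpar]
      simp only [gkInf, hk, hpar, dif_pos, if_true, e1, eval_gσ]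
      simpa [mul_comm] using (hu ⟨k / 2 + 1, by omega⟩).sin
    · have e1 : ∀ y : ClassicalSwing.State (n + 1),
          embedRel δs y k = 1 - cos (u δs y ⟨k / 2 + 1, by omega⟩) :=
        fun y => by rw [embedRel_of_lt δs y hk, embed_odd δs y hk hpar]
      simp only [gkInf, hk, hpar, dif_pos, if_false, e1, eval_gκ]
      simpa [mul_comm] using ((hu ⟨k / 2 + 1, by omega⟩).cos).const_sub 1
  · by_cases hk' : k < 3 * n
    · have hi : (⟨k - 2 * n + 1, by omega⟩ : Fin (n + 1)) ≠ 0 := by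
        intro h'; have := congrArg Fin.val h'; simp at this
      simp only [gkInf, hk, hk', dif_neg, dif_pos, not_false_eq_true, embedRel_mid δs _ hk hk',
        d.eval_gωInf _ h _ (hM _) hω0]
      have h3 := (h2 _ hi).sub h20
      rw [sub_zero] at h3
      exact h3
    · simp only [gkInf, hk, hk', dif_neg, not_false_eq_true, embedRel_high δs _ hk', eval_nil]
      exact hasDerivWithinAt_const _ _ _

end RecastData

end Summit.Ventures.GridStability.Models
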